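import Mathlib.Topology.MetricSpace.Pseudo.Lemmas
import Literature.Barriers.NavierStokesRegularity.NavierStokesInequalityOscillationSmooth
import HarnessLib

/-!
# Oscillatory processes for Scheffer's NSI block, III: Ożański's Theorem 10

Third support file on the discharge path of `NSIBlock_of_arrangement` (fact D of
`NavierStokesInequalityArrangement`; Ożański 2017, §4). We PROVE W. S. Ożański, arXiv:1709.00602,
**Theorem 10** (existence of the oscillatory processes, §4.3; sequential numbering of the held
text, = Theorem 4.3 in the section-wise numbering of arXiv v4): there are
`a₁ᵏ, a₂ᵏ ∈ C^∞(ℝ; [-1,1])`, `k ≥ 1`, such that for all bounded, uniformly continuous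
`Gᵢ : P × [0,T] → ℝ`, `F_{i,l} : P × [0,T] × [-1,1] → ℝ` (`i, l = 1, 2`)
with `F_{i,l}(x,t,-1) = F_{i,l}(x,t,1)`,
`∫₀ᵗ aᵢᵏ(s) (Gᵢ(x,s) + F_{i,1}(x,s,a₁ᵏ(s)) + F_{i,2}(x,s,a₂ᵏ(s))) ds` converges, uniformly in
`(x,t) ∈ P × [0,T]`, to `½ ∫₀ᵗ (F_{2,1}(x,s,1) - F_{2,1}(x,s,0)) ds` for `i = 2` and to `0` for
`i = 1` ((4.22)). The processes are the explicit smoothings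
`Scheffer.oscProcess T k i = process cⁱ (T/(4k)) (k+1) (4k)` of the square waves
`b₁ᵏ, b₂ᵏ` with quarter values `c¹ = (1,-1,0,0)`, `c² = (1,1,-1,-1)` ((4.24), (4.28)); the
proof is Ożański's (pp. 17–19): on the plateaus the integrand is a square wave times a
continuous function, whose integral is computed by the averaging estimate (4.30)–(4.31)
(`abs_integral_wave_mul_sub_le`, `abs_integral_sub_sum_le` of parts I–II), the symmetry
`F(·,·,-1) = F(·,·,1)` making the choice of signs "pick" exactly the pair `(i,l) = (2,1)`
((4.25)); the smoothing costs `O(N/k)` (`abs_integral_le_of_eqOn_plateau_zero`).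

## Rendering

* Indices `i, l ∈ {1,2}` are `Fin 2` (`0` ↦ his `1`, `1` ↦ his `2`).
* "`P`" is any subset of any pseudo-metric space (Ożański: the half-plane; `x` plays no role in
  the proof, p. 18), and "bounded and uniformly continuous on `P × [0,T] (× [-1,1])`" is
  rendered by what the proof uses: a uniform bound `N`, joint continuity of
  `(s,b) ↦ F_{i,l}(x,s,b)` on `[0,T] × [-1,1]` for each `x ∈ P`, and moduli of continuity in `s`
  uniform in `(i, l, x, b)`; all three follow from the printed hypothesis
  (`exists_oscillatoryProcesses`).
* "uniformly in `(x,t) ∈ P × [0,T]` as `k → ∞`" is the `ε`–`K` statement of `oscProcess_spec`.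

## References

* W. S. Ożański, arXiv:1709.00602 (2017), §4.3, Theorem 10 and its proof ((4.22)–(4.31)).
  [`Ozanski2017NSIInternal`]
-/

noncomputable section

open Set MeasureTheory intervalIntegral Function
open scoped Interval ContDiff

namespace Literature.Barriers.NavierStokesRegularity

namespace Scheffer

/-! ### The processes -/

/-- Quarter values `c¹ = (1, -1, 0, 0)` of `b₁` (Ożański 2017, (4.24): `b₁ = 1, -1, 0` on
`(0,T/4), (T/4,T/2), (T/2,T)`). [cite: Ozanski2017NSIInternal, §4.3 (4.24)] -/
def quarterValues₁ : Fin 4 → ℝ :=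
  ![1, -1, 0, 0]

/-- Quarter values `c² = (1, 1, -1, -1)` of `b₂` (Ożański 2017, (4.24): `b₂ = 1, -1` on
`(0,T/2), (T/2,T)`). [cite: Ozanski2017NSIInternal, §4.3 (4.24)] -/
def quarterValues₂ : Fin 4 → ℝ :=
  ![1, 1, -1, -1]

/-- The quarter values of the process `aᵢ`, `i ∈ {0,1}` (= Ożański's `1, 2`). [cite: Ozanski2017NSIInternal, §4.3 (4.24)] -/
def quarterValues (i : Fin 2) : Fin 4 → ℝ :=
  if i = 0 then quarterValues₁ else quarterValues₂

/-- **Ożański's oscillatory processes** `aᵢᵏ` on `[0,T]` (Thm. 10; (4.28) and p. 19): the smoothed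
square wave with quarter values `cⁱ`, quarter length `T/(4k)` (period `T/k`), sharpness `k+1`
and `4k` quarters. [cite: Ozanski2017NSIInternal, Thm. 10] -/
def oscProcess (T : ℝ) (k : ℕ) (i : Fin 2) : ℝ → ℝ :=
  process (quarterValues i) (T / (4 * k)) (k + 1) (4 * k)

/-- The quarter values are bounded by `1`. [folklore] -/
theorem abs_quarterValues_le (i : Fin 2) (j : Fin 4) : |quarterValues i j| ≤ 1 := by
  fin_cases i <;> fin_cases j <;> simp [quarterValues, quarterValues₁, quarterValues₂]

/-- **The processes are smooth**: `aᵢᵏ ∈ C^∞(ℝ)`. [cite: Ozanski2017NSIInternal, Thm. 10] -/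
theorem contDiff_oscProcess (T : ℝ) (k : ℕ) (i : Fin 2) : ContDiff ℝ ∞ (oscProcess T k i) :=
  contDiff_process _ _ _ _

/-- **The processes take values in `[-1,1]`**. [cite: Ozanski2017NSIInternal, Thm. 10] -/
theorem abs_oscProcess_le_one {T : ℝ} (hT : 0 < T) (k : ℕ) (i : Fin 2) (s : ℝ) :
    |oscProcess T k i s| ≤ 1 := by
  rcases k.eq_zero_or_pos with hk | hk
  · subst hk
    simp [oscProcess]
  · exact abs_process_le_one (abs_quarterValues_le i) (by positivity) (by positivity) _ _

/-- The processes take values in `[-1,1]` (interval form). [cite: Ozanski2017NSIInternal, Thm. 10] -/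
theorem oscProcess_mem_Icc {T : ℝ} (hT : 0 < T) (k : ℕ) (i : Fin 2) (s : ℝ) :
    oscProcess T k i s ∈ Icc (-1 : ℝ) 1 :=
  abs_le.1 (abs_oscProcess_le_one hT k i s)

/-! ### The plateau identities (Ożański (4.25)) -/

/-- On a plateau of quarter `j < 4k` both processes take their quarter values and the square
waves with any quarter values `c` take the value `c_{j mod 4}`. [cite: Ozanski2017NSIInternal, §4.3 (4.28)] -/
theorem oscProcess_eq_and_wave_eq {T : ℝ} (hT : 0 < T) {k : ℕ} (hk : 0 < k) {j : ℕ}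
    (hj : j < 4 * k) {s : ℝ}
    (hs : s ∈ Icc ((j : ℝ) * (T / (4 * k)) + T / (4 * k) / (2 * (k + 1)))
      (((j : ℝ) + 1) * (T / (4 * k)) - T / (4 * k) / (2 * (k + 1)))) :
    (∀ i, oscProcess T k i s = quarterValues i ⟨j % 4, Nat.mod_lt _ (by norm_num)⟩) ∧
      ∀ c : Fin 4 → ℝ, wave c (T / (4 * k)) s = c ⟨j % 4, Nat.mod_lt _ (by norm_num)⟩ := by
  have hk' : (0 : ℝ) < k := by exact_mod_cast hk
  have hh : 0 < T / (4 * k) := by positivity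
  have hR : (0 : ℝ) < k + 1 := by positivity
  have hw : 0 < T / (4 * k) / (2 * (k + 1)) := by positivity
  have hs' : |s - ((j : ℝ) + 1 / 2) * (T / (4 * k))| ≤
      T / (4 * k) / 2 - T / (4 * k) / (2 * (k + 1)) :=
    abs_sub_midpoint_le (h := T / (4 * k)) (R := (k : ℝ) + 1) (j := j) (s := s) hs
  refine ⟨fun i => ?_, fun c => ?_⟩
  · unfold oscProcess
    exact process_eq hh hR hj hs'
  · exact wave_eqOn hh c j ⟨by linarith [hs.1], by linarith [hs.2]⟩

/-! ### Theorem 10 -/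

/-- **Ożański's Theorem 10 (existence of the oscillatory processes), quantitative core.** Let
`T > 0`, `P` a set of parameters, `Gᵢ : P × [0,T] → ℝ` and `F_{i,l} : P × [0,T] × [-1,1] → ℝ`
(`i, l ∈ {0,1}`) be bounded by `N`, continuous in `(s,b)`, uniformly equicontinuous in `s`, with
`F_{i,l}(x,s,-1) = F_{i,l}(x,s,1)`. Then for every `ε > 0` there is `K` such that for all
`k ≥ K`, `x ∈ P`, `t ∈ [0,T]`, with `aᵢ = oscProcess T k i`:
`|∫₀ᵗ a₁ (G₁ + F₁₀(a₀) + F₁₁(a₁)) ds - ½∫₀ᵗ (F₁₀(x,s,1) - F₁₀(x,s,0)) ds| ≤ ε` and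
`|∫₀ᵗ a₀ (G₀ + F₀₀(a₀) + F₀₁(a₁)) ds| ≤ ε` — i.e. (4.22): convergence to
`½∫₀ᵗ(F_{2,1}(x,s,1) - F_{2,1}(x,s,0)) ds` for his `i = 2` and to `0` for his `i = 1`, uniformly
in `(x,t) ∈ P × [0,T]`. [cite: Ozanski2017NSIInternal, Thm. 10] -/
theorem oscProcess_spec {T : ℝ} (hT : 0 < T) {X : Type*} (P : Set X)
    (G : Fin 2 → X → ℝ → ℝ) (F : Fin 2 → Fin 2 → X → ℝ → ℝ → ℝ) (N : ℝ)
    (hGN : ∀ i, ∀ x ∈ P, ∀ s ∈ Icc 0 T, |G i x s| ≤ N)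
    (hFN : ∀ i l, ∀ x ∈ P, ∀ s ∈ Icc 0 T, ∀ b ∈ Icc (-1 : ℝ) 1, |F i l x s b| ≤ N)
    (hFc : ∀ i l, ∀ x ∈ P, ContinuousOn (uncurry (F i l x)) (Icc 0 T ×ˢ Icc (-1) 1))
    (hGu : ∀ ε > 0, ∃ δ > 0, ∀ i, ∀ x ∈ P, ∀ s ∈ Icc 0 T, ∀ s' ∈ Icc 0 T,
      |s - s'| < δ → |G i x s - G i x s'| ≤ ε)
    (hFu : ∀ ε > 0, ∃ δ > 0, ∀ i l, ∀ x ∈ P, ∀ b ∈ Icc (-1 : ℝ) 1, ∀ s ∈ Icc 0 T, ∀ s' ∈ Icc 0 T,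
      |s - s'| < δ → |F i l x s b - F i l x s' b| ≤ ε)
    (hFsymm : ∀ i l, ∀ x ∈ P, ∀ s ∈ Icc 0 T, F i l x s (-1) = F i l x s 1) :
    ∀ ε > 0, ∃ K : ℕ, ∀ k ≥ K, ∀ x ∈ P, ∀ t ∈ Icc 0 T,
      |(∫ s in 0..t, oscProcess T k 1 s *
          (G 1 x s + F 1 0 x s (oscProcess T k 0 s) + F 1 1 x s (oscProcess T k 1 s))) -
        1 / 2 * ∫ s in 0..t, (F 1 0 x s 1 - F 1 0 x s 0)| ≤ ε ∧
      |∫ s in 0..t, oscProcess T k 0 s *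
          (G 0 x s + F 0 0 x s (oscProcess T k 0 s) + F 0 1 x s (oscProcess T k 1 s))| ≤ ε := by
  intro ε hε
  -- a positive common bound
  set N' : ℝ := max N 1 with hN'_def
  have hN'1 : 1 ≤ N' := le_max_right _ _
  have hN'0 : 0 < N' := lt_of_lt_of_le one_pos hN'1
  have hGN' : ∀ i, ∀ x ∈ P, ∀ s ∈ Icc 0 T, |G i x s| ≤ N' := fun i x hx s hs =>
    (hGN i x hx s hs).trans (le_max_left _ _)
  have hFN' : ∀ i l, ∀ x ∈ P, ∀ s ∈ Icc 0 T, ∀ b ∈ Icc (-1 : ℝ) 1, |F i l x s b| ≤ N' :=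
    fun i l x hx s hs b hb => (hFN i l x hx s hs b hb).trans (le_max_left _ _)
  -- moduli at the scale `ε' = ε/(36T)`
  set ε' : ℝ := ε / (36 * T) with hε'_def
  have hε' : 0 < ε' := by positivity
  obtain ⟨δ₁, hδ₁, hG⟩ := hGu ε' hε'
  obtain ⟨δ₂, hδ₂, hF⟩ := hFu ε' hε'
  -- choice of `K`
  obtain ⟨K, hK⟩ := exists_nat_gt (max (T / min δ₁ δ₂) (60 * N' * T / ε))
  refine ⟨K + 1, fun k hk x hx t ht => ?_⟩
  have hk0 : 0 < k := by omega
  have hk' : (0 : ℝ) < k := by exact_mod_cast hk0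
  have hkK : (K : ℝ) < k := by exact_mod_cast hk
  have hKδ : T / min δ₁ δ₂ < k := (le_max_left _ _).trans_lt (hK.trans hkK)
  have hKε : 60 * N' * T / ε < k := (le_max_right _ _).trans_lt (hK.trans hkK)
  have hTk : T / k < min δ₁ δ₂ := by
    rw [div_lt_iff₀ hk']
    rw [div_lt_iff₀ (lt_min hδ₁ hδ₂)] at hKδ
    linarith
  have hTk₁ : T / k < δ₁ := hTk.trans_le (min_le_left _ _)
  have hTk₂ : T / k < δ₂ := hTk.trans_le (min_le_right _ _)
  have hNk : 30 * N' * (T / k) ≤ ε / 2 := by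
    rw [div_lt_iff₀ hε] at hKε
    rw [mul_div_assoc', div_le_iff₀ hk']
    linarith
  have hεT : 18 * ε' * T = ε / 2 := by rw [hε'_def]; field_simp; ring
  have hk1 : T / ((k : ℝ) + 1) ≤ T / k := by gcongr; linarith
  -- notation for the processes and their properties
  set a₀ : ℝ → ℝ := oscProcess T k 0 with ha₀
  set a₁ : ℝ → ℝ := oscProcess T k 1 with ha₁
  have ha₀m : ∀ s, a₀ s ∈ Icc (-1 : ℝ) 1 := oscProcess_mem_Icc hT k 0
  have ha₁m : ∀ s, a₁ s ∈ Icc (-1 : ℝ) 1 := oscProcess_mem_Icc hT k 1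
  have ha₀c : Continuous a₀ := (contDiff_oscProcess T k 0).continuous
  have ha₁c : Continuous a₁ := (contDiff_oscProcess T k 1).continuous
  -- continuity of the data in `s`
  have hGc : ∀ i, ContinuousOn (G i x) (Icc 0 T) := fun i =>
    continuousOn_of_modulus fun e he => by
      obtain ⟨δ, hδ, hmod⟩ := hGu e he
      exact ⟨δ, hδ, fun s hs s' hs' hd => hmod i x hx s hs s' hs' hd⟩
  have hFb : ∀ i l, ∀ b ∈ Icc (-1 : ℝ) 1, ContinuousOn (fun s => F i l x s b) (Icc 0 T) :=
    fun i l b hb => continuousOn_comp_of_mem (hFc i l x hx) continuous_const fun _ => hb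
  have h1m : (1 : ℝ) ∈ Icc (-1 : ℝ) 1 := ⟨by norm_num, le_rfl⟩
  have h0m : (0 : ℝ) ∈ Icc (-1 : ℝ) 1 := ⟨by norm_num, by norm_num⟩
  -- the two integrands are continuous, hence integrable, on `[0,T]`
  have hAc : ∀ i, ContinuousOn
      (fun s => oscProcess T k i s * (G i x s + F i 0 x s (a₀ s) + F i 1 x s (a₁ s)))
      (Icc 0 T) := fun i =>
    (contDiff_oscProcess T k i).continuous.continuousOn.mul
      (((hGc i).add (continuousOn_comp_of_mem (hFc i 0 x hx) ha₀c ha₀m)).add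
        (continuousOn_comp_of_mem (hFc i 1 x hx) ha₁c ha₁m))
  have hAI : ∀ i, IntervalIntegrable
      (fun s => oscProcess T k i s * (G i x s + F i 0 x s (a₀ s) + F i 1 x s (a₁ s)))
      volume 0 T := fun i => by
    have h := hAc i
    rw [← uIcc_of_le hT.le] at h
    exact h.intervalIntegrable
  have hAB : ∀ i, ∀ s ∈ Icc 0 T,
      |oscProcess T k i s * (G i x s + F i 0 x s (a₀ s) + F i 1 x s (a₁ s))| ≤ 3 * N' :=
    fun i s hs => by
    rw [abs_mul]
    have h1 : |G i x s + F i 0 x s (a₀ s) + F i 1 x s (a₁ s)| ≤ 3 * N' := by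
      calc |G i x s + F i 0 x s (a₀ s) + F i 1 x s (a₁ s)|
          ≤ |G i x s| + |F i 0 x s (a₀ s)| + |F i 1 x s (a₁ s)| := abs_add_three _ _ _
        _ ≤ N' + N' + N' := add_le_add (add_le_add (hGN' i x hx s hs)
            (hFN' i 0 x hx s hs _ (ha₀m s))) (hFN' i 1 x hx s hs _ (ha₁m s))
        _ = 3 * N' := by ring
    calc |oscProcess T k i s| * |G i x s + F i 0 x s (a₀ s) + F i 1 x s (a₁ s)| ≤ 1 * (3 * N') :=
          mul_le_mul (abs_oscProcess_le_one hT k i s) h1 (abs_nonneg _) zero_le_one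
      _ = 3 * N' := one_mul _
  -- moduli of the model functions (common bound `3ε'`, common sup bound `3N'`)
  have hmodG : ∀ i, ∀ s ∈ Icc 0 T, ∀ s' ∈ Icc 0 T, |s - s'| ≤ T / k →
      |G i x s - G i x s'| ≤ ε' := fun i s hs s' hs' hd =>
    hG i x hx s hs s' hs' (hd.trans_lt hTk₁)
  have hmodF : ∀ i l, ∀ b ∈ Icc (-1 : ℝ) 1, ∀ s ∈ Icc 0 T, ∀ s' ∈ Icc 0 T, |s - s'| ≤ T / k →
      |F i l x s b - F i l x s' b| ≤ ε' := fun i l b hb s hs s' hs' hd =>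
    hF i l x hx b hb s hs s' hs' (hd.trans_lt hTk₂)
  constructor
  · ---------------------------------------------------------------- `i = 1` (Ożański's `i = 2`)
    -- model: `wave c² · (G₁ + F₁₁(·,1)) + wave (1,1,0,0) · F₁₀(·,1) + wave (0,0,-1,-1) · F₁₀(·,0)`
    let c : Fin 3 → Fin 4 → ℝ := ![quarterValues₂, ![1, 1, 0, 0], ![0, 0, -1, -1] ]
    let φ : Fin 3 → ℝ → ℝ :=
      ![fun s => G 1 x s + F 1 1 x s 1, fun s => F 1 0 x s 1, fun s => F 1 0 x s 0]
    have hc : ∀ r j, |c r j| ≤ 1 := by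
      intro r j
      fin_cases r <;> fin_cases j <;> simp [c, quarterValues₂]
    have hφc : ∀ r, ContinuousOn (φ r) (Icc 0 T) := by
      intro r
      fin_cases r
      · exact (hGc 1).add (hFb 1 1 1 h1m)
      · exact hFb 1 0 1 h1m
      · exact hFb 1 0 0 h0m
    have hφN : ∀ r, ∀ s ∈ Icc 0 T, |φ r s| ≤ 3 * N' := by
      intro r s hs
      fin_cases r
      · calc |G 1 x s + F 1 1 x s 1| ≤ |G 1 x s| + |F 1 1 x s 1| := abs_add_le _ _
          _ ≤ N' + N' := add_le_add (hGN' 1 x hx s hs) (hFN' 1 1 x hx s hs 1 h1m)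
          _ ≤ 3 * N' := by linarith
      · exact (hFN' 1 0 x hx s hs 1 h1m).trans (by linarith)
      · exact (hFN' 1 0 x hx s hs 0 h0m).trans (by linarith)
    have hφε : ∀ r, ∀ s ∈ Icc 0 T, ∀ s' ∈ Icc 0 T, |s - s'| ≤ T / k →
        |φ r s - φ r s'| ≤ 3 * ε' := by
      intro r s hs s' hs' hd
      fin_cases r
      · calc |G 1 x s + F 1 1 x s 1 - (G 1 x s' + F 1 1 x s' 1)|
            = |(G 1 x s - G 1 x s') + (F 1 1 x s 1 - F 1 1 x s' 1)| := by ring_nf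
          _ ≤ |G 1 x s - G 1 x s'| + |F 1 1 x s 1 - F 1 1 x s' 1| := abs_add_le _ _
          _ ≤ ε' + ε' := add_le_add (hmodG 1 s hs s' hs' hd) (hmodF 1 1 1 h1m s hs s' hs' hd)
          _ ≤ 3 * ε' := by linarith
      · exact (hmodF 1 0 1 h1m s hs s' hs' hd).trans (by linarith)
      · exact (hmodF 1 0 0 h0m s hs s' hs' hd).trans (by linarith)
    -- the plateau identity
    have hAg : ∀ j < 4 * k, ∀ s ∈ Icc ((j : ℝ) * (T / (4 * k)) + T / (4 * k) / (2 * (k + 1)))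
        (((j : ℝ) + 1) * (T / (4 * k)) - T / (4 * k) / (2 * (k + 1))),
        oscProcess T k 1 s * (G 1 x s + F 1 0 x s (a₀ s) + F 1 1 x s (a₁ s)) =
          ∑ r, wave (c r) (T / (4 * k)) s * φ r s := by
      intro j hj s hs
      obtain ⟨hproc, hwave⟩ := oscProcess_eq_and_wave_eq hT hk0 hj hs
      have hs0T : s ∈ Icc 0 T := by
        have hw : 0 < T / (4 * k) / (2 * ((k : ℝ) + 1)) := by positivity
        have hjk : ((j : ℝ) + 1) * (T / (4 * k)) ≤ T := by
          have : (j : ℝ) + 1 ≤ 4 * k := by exact_mod_cast hj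
          calc ((j : ℝ) + 1) * (T / (4 * k)) ≤ (4 * k) * (T / (4 * k)) := by gcongr
            _ = T := by field_simp
        exact ⟨le_trans (by positivity) hs.1, hs.2.trans (by linarith)⟩
      have hsymm := hFsymm 1 0 x hx s hs0T
      have hsymm' := hFsymm 1 1 x hx s hs0T
      rw [ha₀, ha₁, hproc 0, hproc 1, Fin.sum_univ_three, hwave, hwave, hwave]
      generalize (⟨j % 4, Nat.mod_lt _ (by norm_num)⟩ : Fin 4) = q
      fin_cases q <;>
        simp [c, φ, quarterValues, quarterValues₁, quarterValues₂, hsymm, hsymm'] <;> ring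
    have key := abs_integral_sub_sum_le hT hk0 c hc φ hφc hφN hφε (hAI 1) (hAB 1) hAg ht
    -- identify the limit
    have hI1 : IntervalIntegrable (fun s => F 1 0 x s 1) volume 0 t := by
      have h := (hFb 1 0 1 h1m).mono (Icc_subset_Icc le_rfl ht.2)
      rw [← uIcc_of_le ht.1] at h
      exact h.intervalIntegrable
    have hI0 : IntervalIntegrable (fun s => F 1 0 x s 0) volume 0 t := by
      have h := (hFb 1 0 0 h0m).mono (Icc_subset_Icc le_rfl ht.2)
      rw [← uIcc_of_le ht.1] at h
      exact h.intervalIntegrable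
    have hlim : ∑ r, (∑ j, c r j) / 4 * ∫ s in 0..t, φ r s =
        1 / 2 * ∫ s in 0..t, (F 1 0 x s 1 - F 1 0 x s 0) := by
      rw [intervalIntegral.integral_sub hI1 hI0, Fin.sum_univ_three]
      simp only [c, φ, Fin.sum_univ_four, quarterValues₂, Matrix.cons_val_zero, Matrix.cons_val_one,
        Matrix.cons_val]
      ring
    rw [← hlim]
    refine key.trans ?_
    calc (3 * N' + (3 : ℕ) * (3 * N')) * (T / (k + 1)) + (3 : ℕ) * (2 * (3 * ε') * T + 2 * (3 * N') * (T / k))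
        ≤ 12 * N' * (T / k) + (18 * ε' * T + 18 * N' * (T / k)) := by
          push_cast
          nlinarith [hk1, hN'0.le, div_nonneg hT.le hk'.le]
      _ = 18 * ε' * T + 30 * N' * (T / k) := by ring
      _ ≤ ε / 2 + ε / 2 := add_le_add hεT.le hNk
      _ = ε := by ring
  · ---------------------------------------------------------------- `i = 0` (Ożański's `i = 1`)
    -- model: `wave c¹ · (G₀ + F₀₀(·,1) + F₀₁(·,1))`
    let c : Fin 1 → Fin 4 → ℝ := ![quarterValues₁]
    let φ : Fin 1 → ℝ → ℝ := ![fun s => G 0 x s + F 0 0 x s 1 + F 0 1 x s 1]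
    have hc : ∀ r j, |c r j| ≤ 1 := by
      intro r j
      fin_cases r; fin_cases j <;> simp [c, quarterValues₁]
    have hφc : ∀ r, ContinuousOn (φ r) (Icc 0 T) := by
      intro r
      fin_cases r
      exact ((hGc 0).add (hFb 0 0 1 h1m)).add (hFb 0 1 1 h1m)
    have hφN : ∀ r, ∀ s ∈ Icc 0 T, |φ r s| ≤ 3 * N' := by
      intro r s hs
      fin_cases r
      calc |G 0 x s + F 0 0 x s 1 + F 0 1 x s 1| ≤ |G 0 x s| + |F 0 0 x s 1| + |F 0 1 x s 1| :=
            abs_add_three _ _ _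
        _ ≤ N' + N' + N' := add_le_add (add_le_add (hGN' 0 x hx s hs) (hFN' 0 0 x hx s hs 1 h1m))
            (hFN' 0 1 x hx s hs 1 h1m)
        _ = 3 * N' := by ring
    have hφε : ∀ r, ∀ s ∈ Icc 0 T, ∀ s' ∈ Icc 0 T, |s - s'| ≤ T / k →
        |φ r s - φ r s'| ≤ 3 * ε' := by
      intro r s hs s' hs' hd
      fin_cases r
      calc |G 0 x s + F 0 0 x s 1 + F 0 1 x s 1 - (G 0 x s' + F 0 0 x s' 1 + F 0 1 x s' 1)|
          = |(G 0 x s - G 0 x s') + (F 0 0 x s 1 - F 0 0 x s' 1) + (F 0 1 x s 1 - F 0 1 x s' 1)| := by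
            ring_nf
        _ ≤ |G 0 x s - G 0 x s'| + |F 0 0 x s 1 - F 0 0 x s' 1| + |F 0 1 x s 1 - F 0 1 x s' 1| :=
            abs_add_three _ _ _
        _ ≤ ε' + ε' + ε' := add_le_add (add_le_add (hmodG 0 s hs s' hs' hd)
            (hmodF 0 0 1 h1m s hs s' hs' hd)) (hmodF 0 1 1 h1m s hs s' hs' hd)
        _ = 3 * ε' := by ring
    have hAg : ∀ j < 4 * k, ∀ s ∈ Icc ((j : ℝ) * (T / (4 * k)) + T / (4 * k) / (2 * (k + 1)))
        (((j : ℝ) + 1) * (T / (4 * k)) - T / (4 * k) / (2 * (k + 1))),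
        oscProcess T k 0 s * (G 0 x s + F 0 0 x s (a₀ s) + F 0 1 x s (a₁ s)) =
          ∑ r, wave (c r) (T / (4 * k)) s * φ r s := by
      intro j hj s hs
      obtain ⟨hproc, hwave⟩ := oscProcess_eq_and_wave_eq hT hk0 hj hs
      have hs0T : s ∈ Icc 0 T := by
        have hw : 0 < T / (4 * k) / (2 * ((k : ℝ) + 1)) := by positivity
        have hjk : ((j : ℝ) + 1) * (T / (4 * k)) ≤ T := by
          have : (j : ℝ) + 1 ≤ 4 * k := by exact_mod_cast hj
          calc ((j : ℝ) + 1) * (T / (4 * k)) ≤ (4 * k) * (T / (4 * k)) := by gcongr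
            _ = T := by field_simp
        exact ⟨le_trans (by positivity) hs.1, hs.2.trans (by linarith)⟩
      have hsymm := hFsymm 0 0 x hx s hs0T
      have hsymm' := hFsymm 0 1 x hx s hs0T
      rw [ha₀, ha₁, hproc 0, hproc 1, Fin.sum_univ_one, hwave]
      generalize (⟨j % 4, Nat.mod_lt _ (by norm_num)⟩ : Fin 4) = q
      fin_cases q <;>
        simp [c, φ, quarterValues, quarterValues₁, quarterValues₂, hsymm, hsymm']
    have key := abs_integral_sub_sum_le hT hk0 c hc φ hφc hφN hφε (hAI 0) (hAB 0) hAg ht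
    have hlim : ∑ r, (∑ j, c r j) / 4 * ∫ s in 0..t, φ r s = 0 := by
      rw [Fin.sum_univ_one]
      simp [c, Fin.sum_univ_four, quarterValues₁]
    rw [hlim, sub_zero] at key
    refine key.trans ?_
    calc (3 * N' + (1 : ℕ) * (3 * N')) * (T / (k + 1)) + (1 : ℕ) * (2 * (3 * ε') * T + 2 * (3 * N') * (T / k))
        ≤ 6 * N' * (T / k) + (6 * ε' * T + 6 * N' * (T / k)) := by
          push_cast
          nlinarith [hk1, hN'0.le, div_nonneg hT.le hk'.le]
      _ ≤ 18 * ε' * T + 30 * N' * (T / k) := by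
          nlinarith [hε'.le, hT.le, hN'0.le, div_nonneg hT.le hk'.le]
      _ ≤ ε / 2 + ε / 2 := add_le_add hεT.le hNk
      _ = ε := by ring

/-- **Ożański's Theorem 10 (existence of the oscillatory processes), as printed.** There are
`aᵢᵏ ∈ C^∞(ℝ; [-1,1])` (`k ∈ ℕ`, `i ∈ {0,1}` = his `{1,2}`) such that for all bounded and
uniformly continuous `Gᵢ : P × [0,T] → ℝ`, `F_{i,l} : P × [0,T] × [-1,1] → ℝ` with
`F_{i,l}(x,t,-1) = F_{i,l}(x,t,1)`,
`∫₀ᵗ aᵢᵏ(s)(Gᵢ(x,s) + F_{i,0}(x,s,a₀ᵏ(s)) + F_{i,1}(x,s,a₁ᵏ(s))) ds → ½∫₀ᵗ(F_{1,0}(x,s,1) - F_{1,0}(x,s,0)) ds`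
for `i = 1` and `→ 0` for `i = 0`, as `k → ∞`, uniformly in `(x,t) ∈ P × [0,T]` ((4.22); the
processes do not depend on `G`, `F`). Here `P` is any subset of a pseudo-metric space (in print
the half-plane). PROVED (`oscProcess_spec` with `aᵢᵏ = oscProcess T k i`).
[cite: Ozanski2017NSIInternal, Thm. 10] -/
theorem exists_oscillatoryProcesses {T : ℝ} (hT : 0 < T) :
    ∃ a : ℕ → Fin 2 → ℝ → ℝ,
      (∀ k i, ContDiff ℝ ∞ (a k i)) ∧ (∀ k i s, a k i s ∈ Icc (-1 : ℝ) 1) ∧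
      ∀ {X : Type*} [PseudoMetricSpace X] (P : Set X) (G : Fin 2 → X → ℝ → ℝ)
        (F : Fin 2 → Fin 2 → X → ℝ → ℝ → ℝ),
        (∃ N, (∀ i, ∀ x ∈ P, ∀ s ∈ Icc 0 T, |G i x s| ≤ N) ∧
          ∀ i l, ∀ x ∈ P, ∀ s ∈ Icc 0 T, ∀ b ∈ Icc (-1 : ℝ) 1, |F i l x s b| ≤ N) →
        (∀ i, UniformContinuousOn (fun p : X × ℝ => G i p.1 p.2) (P ×ˢ Icc 0 T)) →
        (∀ i l, UniformContinuousOn (fun p : X × ℝ × ℝ => F i l p.1 p.2.1 p.2.2)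
          (P ×ˢ Icc 0 T ×ˢ Icc (-1) 1)) →
        (∀ i l, ∀ x ∈ P, ∀ s ∈ Icc 0 T, F i l x s (-1) = F i l x s 1) →
        ∀ ε > 0, ∃ K : ℕ, ∀ k ≥ K, ∀ x ∈ P, ∀ t ∈ Icc 0 T,
          |(∫ s in 0..t, a k 1 s * (G 1 x s + F 1 0 x s (a k 0 s) + F 1 1 x s (a k 1 s))) -
              1 / 2 * ∫ s in 0..t, (F 1 0 x s 1 - F 1 0 x s 0)| ≤ ε ∧
          |∫ s in 0..t, a k 0 s * (G 0 x s + F 0 0 x s (a k 0 s) + F 0 1 x s (a k 1 s))| ≤ ε := by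
  refine ⟨fun k i => oscProcess T k i, fun k i => contDiff_oscProcess T k i,
    fun k i s => oscProcess_mem_Icc hT k i s, ?_⟩
  intro X _ P G F hb hGuc hFuc hsymm
  obtain ⟨N, hGN, hFN⟩ := hb
  refine oscProcess_spec hT P G F N hGN hFN ?_ ?_ ?_ hsymm
  · intro i l x hx
    have hcont := (hFuc i l).continuousOn
    have hmap : MapsTo (fun q : ℝ × ℝ => (x, q)) (Icc 0 T ×ˢ Icc (-1) 1)
        (P ×ˢ Icc 0 T ×ˢ Icc (-1) 1) := fun q hq => ⟨hx, hq⟩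
    have hc : Continuous fun q : ℝ × ℝ => ((x, q) : X × ℝ × ℝ) := by fun_prop
    exact (hcont.comp hc.continuousOn hmap).congr fun q _ => rfl
  · intro ε hε
    choose δ hδ hmod using fun i => Metric.uniformContinuousOn_iff_le.1 (hGuc i) ε hε
    refine ⟨min (δ 0) (δ 1), lt_min (hδ 0) (hδ 1), fun i x hx s hs s' hs' hd => ?_⟩
    have hdi : |s - s'| ≤ δ i := by
      fin_cases i
      · exact hd.le.trans (min_le_left _ _)
      · exact hd.le.trans (min_le_right _ _)
    have hd' : dist ((x, s) : X × ℝ) (x, s') ≤ δ i := by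
      rw [Prod.dist_eq, dist_self, Real.dist_eq]
      exact max_le (le_trans (abs_nonneg _) hdi) hdi
    have := hmod i (x, s) ⟨hx, hs⟩ (x, s') ⟨hx, hs'⟩ hd'
    rwa [Real.dist_eq] at this
  · intro ε hε
    choose δ hδ hmod using fun i l => Metric.uniformContinuousOn_iff_le.1 (hFuc i l) ε hε
    refine ⟨min (min (δ 0 0) (δ 0 1)) (min (δ 1 0) (δ 1 1)),
      lt_min (lt_min (hδ 0 0) (hδ 0 1)) (lt_min (hδ 1 0) (hδ 1 1)),
      fun i l x hx b hb s hs s' hs' hd => ?_⟩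
    have hdi : |s - s'| ≤ δ i l := by
      fin_cases i <;> fin_cases l
      · exact hd.le.trans ((min_le_left _ _).trans (min_le_left _ _))
      · exact hd.le.trans ((min_le_left _ _).trans (min_le_right _ _))
      · exact hd.le.trans ((min_le_right _ _).trans (min_le_left _ _))
      · exact hd.le.trans ((min_le_right _ _).trans (min_le_right _ _))
    have hd' : dist ((x, s, b) : X × ℝ × ℝ) (x, s', b) ≤ δ i l := by
      rw [Prod.dist_eq, dist_self, Prod.dist_eq, dist_self, Real.dist_eq]
      refine max_le (le_trans (abs_nonneg _) hdi) (max_le hdi (le_trans (abs_nonneg _) hdi))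
    have := hmod i l (x, s, b) ⟨hx, hs, hb⟩ (x, s', b) ⟨hx, hs', hb⟩ hd'
    rwa [Real.dist_eq] at this

end Scheffer

end Literature.Barriers.NavierStokesRegularity
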